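import Literature.NumberTheory.EllipticCurves.Kobayashi2003.TowerSignedSelmerDual
import HarnessLib

/-!
# Kitajima–Otsuki 2018, Main Theorem 1.3 (= Thm. 4.8) for `F = ℚ`, BOTH signs, on the WHOLE dual
# `X^±(E/ℚ(μ_{p^∞})) = Sel^±(F_∞, E[p^∞])^∨` — the PRINTED shape (no `η`-component reading)
# (`E/ℚ`, `p` odd, good reduction, `a_p = 0`; `Λ = ℤ_p[[Gal(F_∞/F_0)]]`, `F_0 = ℚ(μ_p)`)

Topic `Literature/NumberTheory/EllipticCurves`, cluster `KitajimaOtsuki2018` (namespace = path). Third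
transcription of the same theorem in the tree, and the first in its printed shape for the sign `−`:
`PlusSelmerNoFiniteSubmodule.lean` states it over the base `F_0 = ℚ(μ_p)` for the sign `+` on Def.
1.1's object WITHOUT the `m = −1` clause; `EtaSelmerNoFiniteSubmodule.lean` states it for both signs
on the `η`-COMPONENTS of Kobayashi's tower object (reading flag `KO18-eta-summand`). THIS FILE states
it, for both signs, on the Pontryagin-dual datum of the WHOLE `Sel^ε(E/K_∞)` over Kobayashi's tower
`K_∞ = ℚ(μ_{p^∞}) = F_∞` (`Kobayashi2003.TowerSignedSelmerDualData`, sibling file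
`Kobayashi2003/TowerSignedSelmerDual.lean`) — which is the object the theorem is printed about, so NO
`η`-flag is carried. ONE NAMED FACT (`def … : Prop`, D-0014; nothing asserted; no `_holds`) and its
pointwise projection. Cell `bsd-cm` (run/shared/lean/pub/bsd-cm/), seat `bsd-cm-k8i-ty` (D-0074 group
(G), typer); bears on the K8 route `InertBadSignedBranches`, item stmt-BirchSwinnertonDyer-19226
`PrintReadingsInert`, conjunct 2, reading (R2) `Additive.OddBranchStrictMinusNoFiniteSubmoduleAt` (sign
`−`, `η = ω^{(p−1)/2}`), and on cell `bsd-potss`, K8-Gss2 crux (R2±) `NoFiniteSubmoduleSigned` (items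
19117 / 19222 / 19233). HONEST FRAMING (cell bsd-cm): the programme assembles BSD for analytic-rank
`≤ 1` curves strictly from published theorems and TYPES the remainder; BSD is not proved by any of this.

HOW IT IS CONSUMED (not here; Literature imports no Summits file). The `η`-component statement the
consumers read (`hKO` of x1b's P5-5b dictionary theorem / of bsd-potss's Kitajima–Otsuki frames = the
text of `mainThm13_etaSignedSelmerDual_noFiniteSubmodule`) follows from THIS fact by the kernel-proved
descent `Additive.EtaSignedSelmerDualData.forall_finite_eq_bot_of_tower` (cell `bsd-potss`,
`Summits/…/Rank1Residual/Additive/CyclotomicTowerSignedSelmerEtaSummand.lean`: an injective `Λ`-linear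
`X^ε(E/K_∞)^η ↪ X^ε(E/K_∞)` dual to the `η`-average `Σ_{δ∈Δ} η(δ)·conj_δ`, which is onto the
`η`-component because `p ∤ ♯Δ = p − 1`), applied to the Summits twin `Additive.TowerSignedSelmerDualData`
of the datum below (field-identical; transport by `rfl` on every field, as for the `η`-data). That
retires the reading flag `KO18-eta-summand` from those consumers; hypothesis (vi) stays displayed and is
Kobayashi's Thm. 2.2 (`Kobayashi2003.thm22_towerSignedSelmerDual_finite_torsion`, sibling file).

## Source, read at the page (held copy `paper:arxiv-1607.03612` = arXiv:1607.03612v1, the preprint of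
## Tokyo J. Math. 41 (2018) 273–303, doi:10.3836/tjm/1502179270; verbatim)

Introduction (arXiv pp. 1, 3): "Let `p` be an odd prime number, `F_0` a finite extension of `ℚ`,
`F_∞/F_0` the cyclotomic `ℤ_p`-extension and `F_n` the `n`-th layer. Denote
`Λ = ℤ_p[[Gal(F_∞/F_0)]]`." "**Main Theorem 1.3** (Theorem 4.8). Let `F` be a finite extension of `ℚ`,
`F_0 = F(μ_p)`, `F_∞/F_0` the cyclotomic `ℤ_p`-extension, and `E` an elliptic curve defined over a
subfield `F'` of `F`. Let `S_p^{ss}` be the set of all primes of `F'` lying above `p` where `E` has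
supersingular reduction. Assume the following conditions: (i) `E` has good reduction at any prime of
`F'` lying above `p`, (ii) `S_p^{ss}` is nonempty, (iii) any prime `w ∈ S_p^{ss}` is unramified in `F`,
(iv) `F'_w = ℚ_p` for any prime `w ∈ S_p^{ss}` …, (v) `a_w = 1 + p − #Ẽ_w(𝔽_p) = 0` for any prime
`w ∈ S_p^{ss}` …, and (vi) both `Sel^±(F_∞, E[p^∞])^∨` are `Λ`-torsion. Then both
`Sel^±(F_∞, E[p^∞])^∨` have no nontrivial finite `Λ`-submodule." Remark 1.4 (5) (p. 4): "Suppose that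
`E` is defined over `ℚ` and has supersingular reduction at `p` with `a_p = 0`. In this case, one can
actually show that `Sel^±(F_∞, E[p^∞])^∨` is `Λ`-torsion. Our main theorem implies that
`Sel^±(F_∞, E[p^∞])^∨` has no nontrivial finite `Λ`-submodule for any finite abelian field `F_0`."
§2 (p. 6): "**Definition 2.1.** (1) … `E⁺(F_{n,v}) = {P ∈ E(F_{n,v}) | Tr_{n/m+1} P ∈ E(F_{m,v}) for
all even m, −1 ≤ m ≤ n−1}`, `E⁻(F_{n,v}) = {P ∈ E(F_{n,v}) | Tr_{n/m+1} P ∈ E(F_{m,v}) for all odd m,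
−1 ≤ m ≤ n−1}` … (2) `Sel^±(F_n, E[p^∞]) := Ker( Sel(F_n, E[p^∞]) → ⊕_{v ∈ S^{ss}_{p,F}}
H¹(F_{n,v}, E[p^∞]) / E^±(F_{n,v}) ⊗ ℚ_p/ℤ_p )`, `Sel^±(F_∞, E[p^∞]) := lim→_n Sel^±(F_n, E[p^∞])` …
`Sel^±(F_∞, E[p^∞])^∨` is known to be `Λ(𝒢_∞)`-torsion in the case `F = ℚ` (cf. [Kob03] Theorem
2.2)." §4 (p. 18): "Let `Γ = Gal(F_∞/F_0)` and `Λ = ℤ_p[[Γ]]`. We fix a topological generator `γ ∈ Γ`.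
Then we identify … `ℤ_p[[Γ]]` with … `ℤ_p[[X]]` by identifying `γ` with `1 + X`."

## Transcription (the case `F = F' = ℚ`: `F_0 = ℚ(μ_p) = K₀`, `F_n = ℚ(μ_{p^{n+1}}) = K_n`,
## `F_∞ = ℚ(μ_{p^∞}) = K_∞`; BOTH signs; the WHOLE dual; flag `KO18-F=Q-Rem14(5)` only)

* For `F = F' = ℚ` conditions (i)–(v) read: `E = V/ℚ` has good reduction at the odd `p` and `a_p = 0`
  ((ii)–(iv) automatic: one prime, `ℚ_p`, unramified); (vi) is discharged in print for `F = ℚ` (§2 p. 6,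
  Remark 1.4 (5)) but is nevertheless KEPT as displayed hypotheses on the datum (finite generation +
  torsion over `ℤ_p[[Γ]]` — exactly the text of `Kobayashi2003.thm22_towerSignedSelmerDual_finite_torsion`;
  flag `KO18-F=Q-Rem14(5)` names this choice and nothing else).
* Def. 2.1's `E^±(F_{n,v})` for `F_{−1} = ℚ` ("`−1 ≤ m ≤ n−1`") IS Kobayashi's `E^±(K_{n,v})` (§2 p. 4:
  even `m`, `0 ≤ m < n` / odd `m`, `−1 ≤ m < n`) = the object file's
  `towerSignedLocalPointsOfEmb (towerSubgroup κ K₀) (closureEmb E) V ε n` WITH its `m = −1` clause for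
  `ε = −1`; `Sel^±(F_n, E[p^∞]) = towerSignedSelmerLayer V κ K₀ ℚ_[p] ε n` (ONE prime of `K_n` above
  `p`, so "⊕ over `v ∈ S^{ss}`" is the single condition imposed at the model `ℚ_[p]` and all its
  `Γ_ℚ`-conjugates; the classical conditions everywhere are `selmerGroupOver`), `Sel^±(F_∞, E[p^∞]) =
  towerSignedSelmerInfty V κ K₀ ℚ_[p] ε`, and `Sel^±(F_∞, E[p^∞])^∨` with its `Λ`-structure
  (`γ ↔ 1 + X`, §4) = ANY `D : Kobayashi2003.TowerSignedSelmerDualData V κ K₀ ℚ_[p] γ ε` for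
  `γ ∈ Gal(ℚ̄/K₀)` with `κ γ` a topological generator of the cyclotomic `κ` (`γ|_{F_∞}` then
  generates `Γ = Gal(F_∞/F_0)` topologically, `F_0 ∩ ℚ_∞ = ℚ`).
* "has no nontrivial finite `Λ`-submodule" = `∀ M : Submodule Λ D.X, Finite M → M = ⊥`.

What is NOT here: `F ≠ ℚ`; Main Theorem 1.7 / Thm. 1.8; the `η`-components (sibling file + the
Summits-side descent); any proof. TODO(general form): `F` any number field with `p` unramified, `E`
over `F' ⊆ F` with `F'_w = ℚ_p`, as printed.

References: [KitajimaOtsuki2018] Main Thm. 1.3 (= Thm. 4.8), Remark 1.4 (5), Def. 2.1, §2 p. 6, §4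
(arXiv:1607.03612 pp. 3, 4, 6, 18); [Kobayashi2003] §2 p. 4, Def. 2.1 and Thm. 2.2 (p. 5), §3 p. 5
(the object and hypothesis (vi)); [GreenbergLNM1716] §1 (p. 60).
-/

noncomputable section

open scoped Classical

open WeierstrassCurve Field Literature.NumberTheory.EllipticCurves
  Literature.NumberTheory.GaloisRepresentations Literature.NumberTheory.EllipticCurves.Kobayashi2003
  ZpExtension

namespace Literature.NumberTheory.EllipticCurves.KitajimaOtsuki2018

/-- **Kitajima–Otsuki 2018, Main Theorem 1.3 (= Thm. 4.8), case `F = F' = ℚ`, BOTH signs, on the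
WHOLE dual: `X^ε(E/ℚ(μ_{p^∞})) = Sel^ε(F_∞, E[p^∞])^∨` has no non-trivial finite `Λ`-submodule.** As
printed: "Let `F` be a finite extension of `ℚ`, `F_0 = F(μ_p)`, `F_∞/F_0` the cyclotomic
`ℤ_p`-extension, and `E` an elliptic curve defined over a subfield `F'` of `F`. … Assume (i) `E` has
good reduction at any prime of `F'` lying above `p`, (ii) `S_p^{ss}` is nonempty, (iii) any prime
`w ∈ S_p^{ss}` is unramified in `F`, (iv) `F'_w = ℚ_p` …, (v) `a_w = 0` …, and (vi) both
`Sel^±(F_∞, E[p^∞])^∨` are `Λ`-torsion. Then both `Sel^±(F_∞, E[p^∞])^∨` have no nontrivial finite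
`Λ`-submodule" (`p` odd; `Λ = ℤ_p[[Gal(F_∞/F_0)]] = ℤ_p[[X]]`, `γ ↔ 1 + X`, §4; Def. 2.1 with
"`−1 ≤ m ≤ n−1`", i.e. Kobayashi's `E^±(K_{n,v})` WITH the `m = −1` clause for the sign `−`; (vi)
discharged in print for `F = ℚ` by §2 p. 6 / Remark 1.4 (5) = Kobayashi's Thm. 2.2, kept displayed —
flag `KO18-F=Q-Rem14(5)`). Here: `K₀ = ℚ(μ_p)` (`IsCyclotomicExtension {p} ℚ K₀`), `V/ℚ` globally
minimal with good reduction at the odd `p` and `a_p = 0`, `κ` the cyclotomic `ℤ_p`-extension of `ℚ`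
with topological generator `γ ∈ Gal(ℚ̄/K₀)`, any sign `ε`, and ANY Pontryagin-dual datum `D` of the
WHOLE `Sel^ε(V/K_∞)` at the model `ℚ_[p]` (`Kobayashi2003.TowerSignedSelmerDualData`) whose module is
finitely generated and `Λ`-torsion: every finite `Λ`-submodule of `D.X` is trivial. This is the
PRINTED shape — the whole dual, no `η`-component reading (the `η`-statement
`mainThm13_etaSignedSelmerDual_noFiniteSubmodule` follows from it by the Summits-side kernel descent
`Additive.EtaSignedSelmerDualData.forall_finite_eq_bot_of_tower`, see the module docstring). Named
fact; nothing asserted; no `_holds`.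
[cite: KitajimaOtsuki2018, Main Thm. 1.3 (= Thm. 4.8) with Def. 2.1, §2 p. 6, Remark 1.4 (5) and §4 (arXiv:1607.03612 pp. 3, 4, 6, 18)]
[cite: Kobayashi2003, §2 p. 4 and Def. 2.1 (p. 5) (the object), Thm. 2.2 (p. 5) (hypothesis (vi) for F = ℚ), §3 p. 5 (γ ↔ 1 + X)] -/
def mainThm13_towerSignedSelmerDual_noFiniteSubmodule : Prop :=
  ∀ (p : ℕ) [Fact p.Prime] (K₀ : Type) [Field K₀] [NumberField K₀] [IsCyclotomicExtension {p} ℚ K₀]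
    [(galRange (K := ℚ) K₀).Normal],
  ∀ (V : WeierstrassCurve ℚ) [V.IsElliptic] [V.IsGloballyMinimal],
    p ≠ 2 → V.HasGoodReductionAtPrime p → V.frobeniusTrace p = 0 →
  ∀ (κ : ZpExtension ℚ p) (γ : absoluteGaloisGroup ℚ),
    κ.IsCyclotomic → κ.IsTopGenerator γ → γ ∈ galRange (K := ℚ) K₀ →
  ∀ (ε : ℤˣ) (D : TowerSignedSelmerDualData V κ K₀ ℚ_[p] γ ε),
    Module.Finite (IwasawaAlgebra p) D.X → Module.IsTorsion (IwasawaAlgebra p) D.X →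
    ∀ M : Submodule (IwasawaAlgebra p) D.X, Finite M → M = ⊥

namespace mainThm13_towerSignedSelmerDual_noFiniteSubmodule

variable (h : mainThm13_towerSignedSelmerDual_noFiniteSubmodule)
  {p : ℕ} [Fact p.Prime] {K₀ : Type} [Field K₀] [NumberField K₀] [IsCyclotomicExtension {p} ℚ K₀]
  [(galRange (K := ℚ) K₀).Normal] {V : WeierstrassCurve ℚ} [V.IsElliptic] [V.IsGloballyMinimal]
  (hp : p ≠ 2) (hgood : V.HasGoodReductionAtPrime p) (hap : V.frobeniusTrace p = 0)
  {κ : ZpExtension ℚ p} {γ : absoluteGaloisGroup ℚ} (hκ : κ.IsCyclotomic) (hγ : κ.IsTopGenerator γ)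
  (hγ₀ : γ ∈ galRange (K := ℚ) K₀) {ε : ℤˣ} (D : TowerSignedSelmerDualData V κ K₀ ℚ_[p] γ ε)

include h hp hgood hap hκ hγ hγ₀

/-- **The theorem applied**: under the fact and hypothesis (vi), a finite `Λ`-submodule of the whole
dual `X^ε(V/K_∞)` is `⊥`. [cite: KitajimaOtsuki2018, Main Thm. 1.3 (= Thm. 4.8) (arXiv:1607.03612 p. 3)] -/
theorem eq_bot (hfg : Module.Finite (IwasawaAlgebra p) D.X)
    (htors : Module.IsTorsion (IwasawaAlgebra p) D.X) (M : Submodule (IwasawaAlgebra p) D.X)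
    (hM : Finite M) : M = ⊥ :=
  h p K₀ V hp hgood hap κ γ hκ hγ hγ₀ ε D hfg htors M hM

/-- **Element form**: under the fact and hypothesis (vi), an element of the whole dual generating a
finite `Λ`-submodule is `0`. [cite: KitajimaOtsuki2018, Main Thm. 1.3 (= Thm. 4.8) (arXiv:1607.03612 p. 3)] -/
theorem eq_zero_of_finite_span (hfg : Module.Finite (IwasawaAlgebra p) D.X)
    (htors : Module.IsTorsion (IwasawaAlgebra p) D.X) (x : D.X)
    (hx : Finite (Submodule.span (IwasawaAlgebra p) {x} : Submodule (IwasawaAlgebra p) D.X)) :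
    x = 0 := by
  have hb := h p K₀ V hp hgood hap κ γ hκ hγ hγ₀ ε D hfg htors _ hx
  have hmem : x ∈ Submodule.span (IwasawaAlgebra p) ({x} : Set D.X) := Submodule.mem_span_singleton_self x
  rw [hb] at hmem
  exact (Submodule.mem_bot (IwasawaAlgebra p)).mp hmem

/-- **With Kobayashi's Thm. 2.2 supplying (vi)**: under both named facts, every finite `Λ`-submodule of
ANY whole dual datum is `⊥` — the unconditional-in-print form for `F = ℚ` (Remark 1.4 (5): "one can
actually show that `Sel^±(F_∞, E[p^∞])^∨` is `Λ`-torsion. Our main theorem implies that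
`Sel^±(F_∞, E[p^∞])^∨` has no nontrivial finite `Λ`-submodule").
[cite: KitajimaOtsuki2018, Remark 1.4 (5) and §2 p. 6 (arXiv:1607.03612 pp. 4, 6)]
[cite: Kobayashi2003, Thm. 2.2 (p. 5)] -/
theorem eq_bot_of_thm22 (h22 : thm22_towerSignedSelmerDual_finite_torsion)
    (M : Submodule (IwasawaAlgebra p) D.X) (hM : Finite M) : M = ⊥ :=
  h p K₀ V hp hgood hap κ γ hκ hγ hγ₀ ε D (h22.moduleFinite hp hgood hap hκ hγ hγ₀ D)
    (h22.isTorsion hp hgood hap hκ hγ hγ₀ D) M hM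

end mainThm13_towerSignedSelmerDual_noFiniteSubmodule

end Literature.NumberTheory.EllipticCurves.KitajimaOtsuki2018

end
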